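import Mathlib.LinearAlgebra.FiniteDimensional.Lemmas
import Mathlib.Algebra.Field.ZMod
import Literature.Computability.Complexity.MultilinearExtension
import HarnessLib

/-!
# Aaronson–Wigderson's algebraic query lemma (Lemmas 4.2, 4.3, 4.5): adversary polynomials

Trunk `CplxCore`, companion of `MultilinearExtension.lean`; the algebraic input of the oracle
separation `NP^A ⊄ P^Ã` (Aaronson–Wigderson, Thm. 5.3; file `AlgebrizationSeparation.lean`).
"The goal will be to show that querying points outside the Boolean cube is useless if one wants
to gain information about values on the Boolean cube ... it will be crucial to give ourselves
sufficient freedom, by using polynomials of multidegree 2 rather than multilinear polynomials"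
(AW §4.2). For a field `F`, a finite set `Y ⊆ Fⁿ` of queried points and a Boolean point `z`, call
`z` *good* if some multiquadratic `u : Fⁿ → F` vanishes on `Y`, is `1` at `z` and `0` at every other
Boolean point, and *bad* otherwise (AW, proof of Lemma 4.5).

* `Multilinear.evalAt Y` — the `F`-linear map `c ↦ (m_c(y))_{y ∈ Y}` from value tables
  `c : {0,1}ⁿ → F` (through the multilinear polynomial `m_c = ofCube c = Σ_a c(a) δ_a`) to `F^Y`;
  its kernel is the space of AW Lemma 4.2 ("`t` linear equations over `F` relating the `2ⁿ`
  coefficients `m_z`").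
* `Multilinear.bad Y` — the Boolean points at which every kernel element vanishes, and
  **`card_bad_le`**: `|bad Y| ≤ |Y|` (AW Lemma 4.3: "for at least `2ⁿ - t` Boolean points `w` there
  exists a multiquadratic extension polynomial `p` with `p(yᵢ) = 0`, `p(w) = 1`, `p(z) = 0` for
  Boolean `z ≠ w`"; proof here by rank–nullity on `F^{{0,1}ⁿ}`: the kernel has dimension
  `≥ 2ⁿ - |Y|` and injects into `F^{good}`).
* **`exists_multiquadratic_of_not_mem_bad`** — AW Lemma 4.3's polynomial `p := m · δ_w` (scaled):
  for a good `z`, `u = m(z)⁻¹ · m · δ_z` is multiquadratic, vanishes on `Y`, and is `[w = z]` at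
  Boolean `w`.
* **`exists_multiquadratic_toggle`** — the many-fields form used in Thm. 5.3 (AW Lemma 4.5 with
  `f = 0`, `p_F = 0`, one toggled point, fields `𝔽_p` for all primes `p`): given finitely many
  queried points `T` (prime, point of `ℕⁿ` read mod `p`) and a set `S` of candidate Boolean points
  with `|T| < |S|`, some `z ∈ S` admits, for every prime `p` simultaneously, a multiquadratic
  `u_p ∈ 𝔽_p[x₁..xₙ]` vanishing at the points of `T` over `𝔽_p`, equal to `1` at `z` and to `0` at
  all other Boolean points ("each `F ∈ 𝓕` can prevent at most `|Y_F|` points from being good.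
  Hence there are at least `2ⁿ - t` good points").

## References

* S. Aaronson, A. Wigderson, *Algebrization: a new barrier in complexity theory*, STOC 2008 /
  ACM TOCT 1 (2009), §4.1, Lemma 4.2, Lemma 4.3 (pp. 18–19), Lemma 4.5 (pp. 19–20), Thm. 4.4.
  [AaronsonWigderson2008]
* M. Juma, V. Kabanets, C. Rackoff, A. Shpilka, *The black-box query complexity of polynomial
  summation*, Comput. Complexity 18 (2009) (why multidegree 2 is needed; cited by AW §4.2).
-/

namespace Literature.Computability.Complexity

open MvPolynomial

namespace Multilinear

section Field

variable {F : Type*} [Field F] {N : ℕ}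

/-! ### The evaluation map at the queried points and its kernel (AW Lemma 4.2) -/

/-- The `F`-linear map `c ↦ (m_c(y))_{y ∈ Y}`: evaluate the multilinear polynomial with value
table `c` on the cube at the queried points `Y ⊆ Fⁿ`. Its kernel is the solution space of the
"`t` linear equations over `F` relating the `2ⁿ` coefficients `m_z`" of AW Lemma 4.2. [cite: AaronsonWigderson2008, Lemma 4.2] -/
noncomputable def evalAt (Y : Finset (Fin N → F)) : ((Fin N → Bool) → F) →ₗ[F] (↥Y → F) :=
  (LinearMap.pi fun y : ↥Y => (aeval (R := F) ((y : Fin N → F))).toLinearMap) ∘ₗ ofCubeₗ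

/-- `evalAt Y c y = m_c(y)`. [cite: AaronsonWigderson2008, Lemma 4.2] -/
@[simp] theorem evalAt_apply (Y : Finset (Fin N → F)) (c : (Fin N → Bool) → F) (y : ↥Y) :
    evalAt Y c y = eval (y : Fin N → F) (ofCube c) := by
  simp [evalAt]

/-- **The bad Boolean points** for the queried set `Y`: those at which every multilinear
polynomial vanishing on `Y` vanishes as well (the complement of AW's "good" points).
[cite: AaronsonWigderson2008, Lemma 4.5 (proof)] -/
noncomputable def bad (Y : Finset (Fin N → F)) : Finset (Fin N → Bool) := by
  classical
  exact Finset.univ.filter fun z => ∀ c ∈ LinearMap.ker (evalAt Y), c z = 0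

/-- Membership in `bad Y`. [cite: AaronsonWigderson2008, Lemma 4.5 (proof)] -/
theorem mem_bad_iff {Y : Finset (Fin N → F)} {z : Fin N → Bool} :
    z ∈ bad Y ↔ ∀ c : (Fin N → Bool) → F, evalAt Y c = 0 → c z = 0 := by
  classical
  simp [bad, LinearMap.mem_ker]

/-- **AW Lemma 4.3 (counting form): at most `|Y|` Boolean points are bad.** Rank–nullity on the
value tables `F^{{0,1}ⁿ}` (dimension `2ⁿ`): the kernel `K` of `evalAt Y` has dimension
`≥ 2ⁿ - |Y|`, and restriction to the good coordinates `K → F^{good}` is injective (a kernel element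
vanishes at the bad coordinates by definition), so `dim K ≤ 2ⁿ - |bad Y|`. (AW: "by basic linear
algebra, it follows that there must be a solution in which at least `2ⁿ - t` of the `m_z`'s are
set to `1`".) [cite: AaronsonWigderson2008, Lemma 4.2 and Lemma 4.3] -/
theorem card_bad_le (Y : Finset (Fin N → F)) : (bad Y).card ≤ Y.card := by
  classical
  set E := evalAt Y with hE
  set K := LinearMap.ker E with hK
  have h1 : Module.finrank F (LinearMap.range E) + Module.finrank F K = Fintype.card (Fin N → Bool) := by
    rw [hK, LinearMap.finrank_range_add_finrank_ker, Module.finrank_fintype_fun_eq_card]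
  have h2 : Module.finrank F (LinearMap.range E) ≤ Y.card :=
    calc Module.finrank F (LinearMap.range E) ≤ Module.finrank F (↥Y → F) := Submodule.finrank_le _
      _ = Y.card := by rw [Module.finrank_fintype_fun_eq_card, Fintype.card_coe]
  -- restriction of kernel elements to the good coordinates
  let R : K →ₗ[F] ({z : Fin N → Bool // z ∉ bad Y} → F) :=
    (LinearMap.pi fun z : {z : Fin N → Bool // z ∉ bad Y} => LinearMap.proj (z : Fin N → Bool)) ∘ₗ K.subtype
  have hR : Function.Injective R := by
    intro c c' h
    apply Subtype.ext
    funext z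
    by_cases hz : z ∈ bad Y
    · have hc : (c : (Fin N → Bool) → F) z = 0 := mem_bad_iff.1 hz c (LinearMap.mem_ker.1 c.2)
      have hc' : (c' : (Fin N → Bool) → F) z = 0 := mem_bad_iff.1 hz c' (LinearMap.mem_ker.1 c'.2)
      rw [hc, hc']
    · exact congrFun h ⟨z, hz⟩
  have h3 : Module.finrank F K ≤ Fintype.card {z : Fin N → Bool // z ∉ bad Y} := by
    have := LinearMap.finrank_le_finrank_of_injective hR
    rwa [Module.finrank_fintype_fun_eq_card] at this
  have h4 : Fintype.card {z : Fin N → Bool // z ∉ bad Y} = Fintype.card (Fin N → Bool) - (bad Y).card := by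
    rw [Fintype.card_subtype_compl, Fintype.card_coe]
  have h5 : (bad Y).card ≤ Fintype.card (Fin N → Bool) := Finset.card_le_univ _
  omega

/-- **AW Lemma 4.3 (the adversary polynomial).** If `z` is good for `Y` — some multilinear `m`
vanishes on `Y` with `m(z) ≠ 0` — then `u := m(z)⁻¹ · m · δ_z` is multiquadratic (degree `≤ 2` in
each variable), vanishes on `Y`, and on the cube equals the indicator of `z`
(AW: "`p(x) := m(x) δ_w(x)`"). [cite: AaronsonWigderson2008, Lemma 4.3] -/
theorem exists_multiquadratic_of_not_mem_bad {Y : Finset (Fin N → F)} {z : Fin N → Bool}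
    (hz : z ∉ bad Y) :
    ∃ u : MvPolynomial (Fin N) F, (∀ i, u.degreeOf i ≤ 2) ∧ (∀ y ∈ Y, eval y u = 0) ∧
      ∀ w : Fin N → Bool, eval (boolPt w) u = if w = z then 1 else 0 := by
  classical
  rw [mem_bad_iff] at hz
  push Not at hz
  obtain ⟨c, hc0, hcz⟩ := hz
  refine ⟨C (c z)⁻¹ * (ofCube c * delta z), fun i => ?_, fun y hy => ?_, fun w => ?_⟩
  · calc (C (c z)⁻¹ * (ofCube c * delta z)).degreeOf i ≤ (ofCube c * delta z).degreeOf i :=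
          degreeOf_C_mul_le _ _ _
      _ ≤ (ofCube c).degreeOf i + (delta z).degreeOf i := degreeOf_mul_le _ _ _
      _ ≤ 1 + 1 := Nat.add_le_add (degreeOf_ofCube_le c i) (degreeOf_delta_le z i)
  · have hy0 : eval y (ofCube c) = 0 := by
      have := congrFun hc0 ⟨y, hy⟩
      simpa using this
    simp [map_mul, hy0]
  · rw [map_mul, map_mul, eval_C, eval_boolPt_ofCube, eval_boolPt_delta]
    by_cases h : w = z
    · subst h
      simp [hcz]
    · rw [if_neg (Ne.symm h), if_neg h, mul_zero, mul_zero]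

end Field

/-! ### Many prime fields at once (AW Lemma 4.5) -/

/-- The points of `T` over `𝔽_p`: those tagged with the prime `p`, read modulo `p`. [cite: AaronsonWigderson2008, Lemma 4.5] -/
noncomputable def pointsMod {N : ℕ} (T : Finset (ℕ × (Fin N → ℕ))) (p : Nat.Primes) : Finset (Fin N → ZMod p) := by
  classical
  exact (T.filter fun t => t.1 = (p : ℕ)).image fun t i => (t.2 i : ZMod p)

/-- A point of `T` tagged `p` is, modulo `p`, a point of `pointsMod T p`. [folklore] -/
theorem mem_pointsMod {N : ℕ} {T : Finset (ℕ × (Fin N → ℕ))} {p : Nat.Primes} {v : Fin N → ℕ}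
    (h : ((p : ℕ), v) ∈ T) : (fun i => (v i : ZMod p)) ∈ pointsMod T p := by
  classical
  unfold pointsMod
  exact Finset.mem_image.2 ⟨((p : ℕ), v), Finset.mem_filter.2 ⟨h, rfl⟩, rfl⟩

/-- There are at most as many points over `𝔽_p` as entries of `T` tagged `p`. [folklore] -/
theorem card_pointsMod_le {N : ℕ} (T : Finset (ℕ × (Fin N → ℕ))) (p : Nat.Primes) :
    (pointsMod T p).card ≤ (T.filter fun t => t.1 = (p : ℕ)).card := by
  classical
  unfold pointsMod
  exact Finset.card_image_le

/-- **AW Lemma 4.5 (the form used for Thm. 5.3).** Let `T` be a finite set of queried points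
(a prime `p` and a point of `ℕⁿ`, read in `𝔽_pⁿ`) and `S` a set of candidate Boolean points with
`|T| < |S|`. Then some `z ∈ S` is good for every prime field simultaneously: for every prime `p`
there is a multiquadratic `u_p ∈ 𝔽_p[x₁, …, xₙ]` with `u_p(y) = 0` at every point of `T` over
`𝔽_p`, `u_p(z) = 1`, and `u_p(w) = 0` at every Boolean `w ≠ z`. (AW: "each `F ∈ 𝓕` can prevent at
most `|Y_F|` points from being good. Hence there are at least `2ⁿ - t` good points"; here with the
ambient function `f = 0` and `p_F = 0`, toggling the single point `z`, as in the proof of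
Thm. 5.3.) [cite: AaronsonWigderson2008, Lemma 4.5 and proof of Thm. 5.3] -/
theorem exists_multiquadratic_toggle {N : ℕ} (S : Finset (Fin N → Bool))
    (T : Finset (ℕ × (Fin N → ℕ))) (hT : T.card < S.card) :
    ∃ z ∈ S, ∀ p : Nat.Primes, ∃ u : MvPolynomial (Fin N) (ZMod p),
      (∀ i, u.degreeOf i ≤ 2) ∧
      (∀ v : Fin N → ℕ, ((p : ℕ), v) ∈ T → eval (fun i => (v i : ZMod p)) u = 0) ∧
      ∀ w : Fin N → Bool, eval (boolPt w) u = if w = z then 1 else 0 := by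
  classical
  -- the prime fields `𝔽_p`, `p : Nat.Primes`
  have hF : ∀ p : Nat.Primes, Fact (p : ℕ).Prime := fun p => ⟨p.2⟩
  -- the primes present in `T`, and the union of their bad sets
  set P₁ : Finset Nat.Primes := (T.image Prod.fst).subtype Nat.Prime with hP₁
  set B : Finset (Fin N → Bool) := P₁.biUnion fun p => bad (pointsMod T p) with hB
  -- `|B| ≤ |T|`
  have hfib : ∑ p ∈ P₁, (T.filter fun t => t.1 = (p : ℕ)).card ≤ T.card := by
    rw [← Finset.card_biUnion]
    · exact Finset.card_le_card (Finset.biUnion_subset.2 fun p _ => Finset.filter_subset _ _)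
    · intro p _ p' _ hpp'
      refine Finset.disjoint_left.2 fun t ht ht' => hpp' (Subtype.ext ?_)
      exact ((Finset.mem_filter.1 ht).2).symm.trans (Finset.mem_filter.1 ht').2
  have hBT : B.card ≤ T.card :=
    calc B.card ≤ ∑ p ∈ P₁, (bad (pointsMod T p)).card := Finset.card_biUnion_le
      _ ≤ ∑ p ∈ P₁, (T.filter fun t => t.1 = (p : ℕ)).card :=
        Finset.sum_le_sum fun p _ => (card_bad_le _).trans (card_pointsMod_le T p)
      _ ≤ T.card := hfib
  -- a candidate point outside all bad sets
  obtain ⟨z, hzS, hzB⟩ := Finset.exists_mem_notMem_of_card_lt_card (hBT.trans_lt hT)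
  refine ⟨z, hzS, fun p => ?_⟩
  have hz : z ∉ bad (pointsMod T p) := by
    by_cases hp : p ∈ P₁
    · exact fun h => hzB (Finset.mem_biUnion.2 ⟨p, hp, h⟩)
    · -- no point of `T` is tagged `p`: the bad set is empty
      have hempty : (T.filter fun t => t.1 = (p : ℕ)).card = 0 := by
        rw [Finset.card_eq_zero, Finset.filter_eq_empty_iff]
        intro t ht htp
        exact hp (Finset.mem_subtype.2 (Finset.mem_image.2 ⟨t, ht, htp⟩))
      have := (card_bad_le (pointsMod T p)).trans (card_pointsMod_le T p)
      rw [hempty, Nat.le_zero, Finset.card_eq_zero] at this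
      simp [this]
  obtain ⟨u, hdeg, hY, hcube⟩ := exists_multiquadratic_of_not_mem_bad hz
  exact ⟨u, hdeg, fun v hv => hY _ (mem_pointsMod hv), hcube⟩

end Multilinear

end Literature.Computability.Complexity
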